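/-
Copyright (c) 2026 the pub-hodgecm-mathlib formalisation cell (harness21).  Prover seat hodgecm-mathlib-F0P3b-p01 (g13): «S3-ram» seeding wave (LEAD F0P3a-plan (g12)
T11-41; owner F0P3a-p06 (g15)), sockets (E) `typeOne_tokens_ram` and (Lit) `typeOne_literals_ram` of A-p16 (g31)'s skeleton v6 a36a7f73 (A′e); 2026-09-02.
-/
import Literature.NumberTheory.Rogawski1990.FinExplicitTransferFactorRamifiedLiterals            -- ★ (iv) (this seat): the signed class sum with the factor `(β, θ)_v · q_v^{−m}` evaluated; brings ★ p847076 assembly∕adapter, ★ p846967 representatives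
import Literature.NumberTheory.Rogawski1990.UnitFundamentalLemmaRamifiedFlickerKappaSigns         -- ★ p846987 (this seat): `finKappaAt_ramified_representative_eq`, `onePlace_frame_of_conj_frame`
import Literature.NumberTheory.Rogawski1990.DepthZeroKappaTransferTypeOne                         -- ★ p846528: the INERT clause (brings the place-generic eigenframe ∕ norm-one ∕ regularity tokens)
import Literature.NumberTheory.Rogawski1990.RamifiedPlaceNormSymbolDichotomy                      -- ★ `hilbertSymbol_eq_one_iff_exists_norm_toPlace` ∕ `…_neg_one_iff_not_…` (the norm reading of `(·, θ)_v`)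
import HarnessLib

/-!
# Sockets (E) `typeOne_tokens_ram` and (Lit) `typeOne_literals_ram` of the (e1) skeleton v6 (A-p16 (g31)): the T5 depth∕discriminant tokens near `1`, and the four
# matched ramified literals with their κ-signs `s·(−1)^{b₁}` and sign base `(s : ℂ) = (y_λ, θ)_v` (Rogawski 1990 §4.9, (4.3.1)–(4.3.2); Flicker 1998 §2, §6)

Topic `NumberTheory/Rogawski1990`; namespace `Literature.NumberTheory.Rogawski1990`.  THEOREMS ONLY (no definition, no named fact, no instance, no notation, no `sorry`).
Cell `pub/hodgecm-mathlib`, crux H413 (`--supports stmt-HodgeConjecture-24833`), «S3-ram» seeding wave, row **«A′e SOCKETS (E)+(Lit)»** of A-p16 (g31)'s skeleton v6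
(HOME `F0/P3a/A-p16/g31/DepthZeroKappaTransferTypeOneRamifiedGSide.skeleton.v6.A-p16g31.lean`, sha16 a36a7f73e2613c67): the two theorems below have EXACTLY the binder lists
and conclusions of the sockets `stub_typeOne_tokens_ram` (:66) and `stub_typeOne_literals_ram` (:92), so that each socket closes by `exact`.
* (E) `typeOne_tokens_ram` — near `1` on the type-(1) population (`G`-regular, a root of `χ_{g,w}` in `L_w`, non-Levi): the depth token `∃ m, |χ_g(u)_w| = |ι_w ϖ_v^m|` and the
  symmetrised discriminant `∃ β ∈ (L⁺_v)ˣ, ι_w β = −χ_g(u)_w (u_w² + det g_w) ∕ (2 u_w² det g_w)` (T5-u-TAME lineage: ★ `exists_units_toPlace_eq_symmDisc_of_deep`,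
  ★ `valued_eval_eq_valued_toPlace_pow_toNat_of_toPlace_eq`, on the neighbourhood where `|u_w − 1| ≤ |ι_w ϖ_v|` and `|χ_g(u)_w| < 1`).
* (Lit) `typeOne_literals_ram` — for every such `γ_H` (the neighbourhood is `univ`): four matched, pairwise non-conjugate representatives `t b₀ b₁` (★ p846967, transported
  along the integral antidiagonal frame `A` of `H′_w`), a one-place type-(1) eigenframe `E(t 0 0) · Q = Q · diag x` with `x = (α_w, u_w, γ_w)` injective and norm-one
  (★ p847076's adapter over the semilocal eigenframe of ★ p846528 §3), the κ-signs `κ_v(γ_H, t_b) = s·(−1)^{b₁}` with `s = [−det H′_w ∈ N(L_w^×)] ∈ {±1}` (★ p846987), and the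
  sign base `(s : ℂ) = (y_λ, θ)_v` for any `y_λ ∈ L⁺_v` with `ι_w y_λ = −det H′_w` (the norm criterion ★ `hilbertSymbol_eq_one_iff_exists_norm_toPlace` ∕ `…_neg_one_iff_not_…`).
Unused frame binders of the sockets (`μ`, `hH′i`, `hμu`, `hμω`, `ϖ`, `hϖ`, `hσϖ` in (Lit); `he` in (E)) are kept, `_`-prefixed, so that the signatures stay positional-identical.
HONEST LABEL: HC_CM is proved only modulo the 2 remaining named inputs (hLiu418 24832, h413 24833) until rung 0 closes; no books consequence.

## References
* [Rogawski1990] J. D. Rogawski, *Automorphic Representations of Unitary Groups in Three Variables*, Ann. of Math. Stud. 123 (1990), §4.9 Prop. 4.9.1 p. 55, Lemma 4.9.3 p. 56,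
  §4.3 (4.3.1)–(4.3.2) p. 43, §3.5 Prop. 3.5.2 (c) p. 29, §3.6 p. 31.
* [Flicker1998UnitaryFL] Y. Z. Flicker, *Elementary proof of the fundamental lemma for a unitary group*, Canad. J. Math. 50 (1998), §2 Prop. 3 pp. 78–79, §6 p. 95.
* [LabesseLanglands1979] J.-P. Labesse, R. P. Langlands, *L-indistinguishability for SL(2)*, Canad. J. Math. 31 (1979), §2.
-/

set_option autoImplicit false

noncomputable section

open NumberField IsDedekindDomain Matrix Filter Topology Polynomial
open scoped MatrixGroups ValuativeRel

namespace Literature.NumberTheory.Rogawski1990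

open Literature.NumberTheory.Automorphic Literature.NumberTheory.Automorphic.UnitaryGroup
open Literature.NumberTheory.GaloisRepresentations Literature.NumberTheory.NumberFields Literature.NumberTheory.QuadraticForms

section Sockets

/-- `χ_g(u)` a unit and `g · P₂ = P₂ · diag(u)` ⇒ `u₀ ≠ u ≠ u₁` (`χ_g = (X − u₀)(X − u₁)` in the eigenframe; a unit is not zero). [cite: Rogawski1990, §4.9 p. 54] -/
theorem ne_finGammaTwo_of_isUnit_eval_of_eigenframe (L : Type) [Field L] [NumberField L] [IsCMField L] (v : HeightOneSpectrum (𝓞 ↥(maximalRealSubfield L)))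
    (a : (UnitaryGroup.cmDatum L 2 (Matrix.of fun i j : Fin 2 => if i.val + j.val + 1 = 2 then (1 : L) else 0)).Local v ×
      (UnitaryGroup.cmDatum L 1 (Matrix.of fun i j : Fin 1 => if i.val + j.val + 1 = 1 then (1 : L) else 0)).Local v)
    (hu : IsUnit ((finCharpolyTwo L v a).eval (finGammaTwo L v a)))
    {P₂ : GL (Fin 2) (UnitaryGroup.LocalRing L v)} {u : Fin 2 → UnitaryGroup.LocalRing L v}
    (hP₂ : (a.1.val.val : Matrix (Fin 2) (Fin 2) (UnitaryGroup.LocalRing L v)) * P₂.val = P₂.val * diagonal u) :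
    u 0 ≠ finGammaTwo L v a ∧ finGammaTwo L v a ≠ u 1 := by
  have hconj : (P₂⁻¹).val * (a.1.val.val : Matrix (Fin 2) (Fin 2) (UnitaryGroup.LocalRing L v)) * P₂.val = diagonal u := by
    rw [Matrix.mul_assoc, hP₂, ← Matrix.mul_assoc, Units.inv_mul, Matrix.one_mul]
  have hchar : finCharpolyTwo L v a = ∏ i : Fin 2, (X - C (u i)) := by
    show (a.1.val.val : Matrix (Fin 2) (Fin 2) (UnitaryGroup.LocalRing L v)).charpoly = _
    rw [← Matrix.charpoly_units_conj' P₂, ← Matrix.coe_units_inv, hconj, Matrix.charpoly_diagonal]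
  rw [hchar, Fin.prod_univ_two, eval_mul, eval_sub, eval_sub, eval_X, eval_C, eval_C] at hu
  constructor
  · intro h; rw [h, sub_self, zero_mul] at hu; exact not_isUnit_zero hu
  · intro h; rw [← h, sub_self, mul_zero] at hu; exact not_isUnit_zero hu

/-! ## §1 SOCKET (E): the depth token and the symmetrised discriminant near `1` -/

set_option maxHeartbeats 800000 in
/-- **SOCKET (E) of skeleton v6 `stub_typeOne_tokens_ram` (A-p16 (g31)), text VERBATIM**: near `1 ∈ H_v`, for `G`-regular `γ_H`, the depth token `∃ m, |χ_g(u)_w| = |ι_w ϖ_v|^m`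
and the symmetrised discriminant `∃ β ∈ (L⁺_v)ˣ, ι_w β = −χ_g(u)_w(u_w² + det g_w)∕(2u_w² det g_w)` — ★ T5 `exists_units_toPlace_eq_symmDisc_of_deep` +
`valued_eval_eq_valued_toPlace_pow_toNat_of_toPlace_eq` on the deep neighbourhood ★ `eventually_nhds_one_valued_sub_one_le` ∩ ★ `eventually_nhds_one_valued_eval_lt_one`;
`χ_g(u)_w ≠ 0` by `G`-regularity (★ `isUnit_eval_finCharpolyTwo_of_isLocalGRegular`).  (`hsplit`, `hlev`, `he` are not used.)
[cite: Rogawski1990, §4.9 p. 55, Lemma 4.9.3 p. 56] [cite: LabesseLanglands1979, §2 (2.1)] -/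
theorem typeOne_tokens_ram
    (L : Type) [Field L] [NumberField L] [IsCMField L]
    {v : HeightOneSpectrum (𝓞 ↥(maximalRealSubfield L))} (w : PlacesOver L v)
    (hw : IsCMField.complexConj L • w.1 = w.1) (_he : v.asIdeal.ramificationIdx' w.1.asIdeal ≠ 1)
    (h2 : IsUnit (2 : 𝒪[(w.1.adicCompletion L)])) :
    ∃ V ∈ 𝓝 (1 : ((cmDatum L 2 (Matrix.of fun i j : Fin 2 => if i.val + j.val + 1 = 2 then (1 : L) else 0)).Local v × (cmDatum L 1 (Matrix.of fun i j : Fin 1 => if i.val + j.val + 1 = 1 then (1 : L) else 0)).Local v)),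
      ∀ γH ∈ V, IsLocalGRegular L v γH →
        (∃ x : (w.1.adicCompletion L), (((γH.1.val : GL (Fin 2) (UnitaryGroup.LocalRing L v)).val.map
          (Pi.evalRingHom (fun w' : PlacesOver L v => w'.1.adicCompletion L) w)).charpoly).IsRoot x) →
        ¬ (∃ (y : ((cmDatum L 2 (Matrix.of fun i j : Fin 2 => if i.val + j.val + 1 = 2 then (1 : L) else 0)).Local v × (cmDatum L 1 (Matrix.of fun i j : Fin 1 => if i.val + j.val + 1 = 1 then (1 : L) else 0)).Local v)) (d' : Fin 2 → (UnitaryGroup.LocalRing L v)ˣ),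
          glDiagonal 2 (UnitaryGroup.LocalRing L v) d' = ((y * γH * y⁻¹).1.val : GL (Fin 2) (UnitaryGroup.LocalRing L v))) →
        (∃ m : ℕ, Valued.v (((finCharpolyTwo L v γH).eval (finGammaTwo L v γH)) w) = Valued.v ((toPlace v w (HeckeCharacter.uniformizer ↥(maximalRealSubfield L) v : v.adicCompletion ↥(maximalRealSubfield L))) ^ m)) ∧
        ∃ β : (v.adicCompletion ↥(maximalRealSubfield L))ˣ, toPlace v w (β : v.adicCompletion ↥(maximalRealSubfield L)) =
            -(((finCharpolyTwo L v γH).eval (finGammaTwo L v γH)) w *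
                (finGammaTwo L v γH w ^ 2 +
                  ((γH.1.val.val : Matrix (Fin 2) (Fin 2) (UnitaryGroup.LocalRing L v)).map
                    (Pi.evalRingHom (fun w' : UnitaryGroup.PlacesOver L v => w'.1.adicCompletion L) w)).det)) /
              (2 * finGammaTwo L v γH w ^ 2 *
                ((γH.1.val.val : Matrix (Fin 2) (Fin 2) (UnitaryGroup.LocalRing L v)).map
                    (Pi.evalRingHom (fun w' : UnitaryGroup.PlacesOver L v => w'.1.adicCompletion L) w)).det) := by
  have h2v : Valued.v (2 : w.1.adicCompletion L) = 1 := (isUnit_two_integer_iff_valued_eq_one L w.1).1 h2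
  have hϖ0 : (toPlace v w (HeckeCharacter.uniformizer ↥(maximalRealSubfield L) v : v.adicCompletion ↥(maximalRealSubfield L))) ^ 1 ≠ 0 :=
    pow_ne_zero _ (toPlace_heckeUniformizer_ne_zero L v w)
  refine (Filter.Eventually.exists_mem ?_)
  filter_upwards [eventually_nhds_one_valued_sub_one_le L v w hϖ0, eventually_nhds_one_valued_eval_lt_one L v w] with γH hγ hχ hreg _ _
  have hunit : IsUnit ((finCharpolyTwo L v γH).eval (finGammaTwo L v γH)) := isUnit_eval_finCharpolyTwo_of_isLocalGRegular L v γH hreg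
  have hχ0 : ((finCharpolyTwo L v γH).eval (finGammaTwo L v γH)) w ≠ 0 :=
    (hunit.map (Pi.evalRingHom (fun w' : PlacesOver L v => w'.1.adicCompletion L) w)).ne_zero
  have hβex := exists_units_toPlace_eq_symmDisc_of_deep L v w hw h2v le_rfl γH hχ0 hγ.1 hγ.2
  obtain ⟨β, hβ⟩ := hβex
  exact ⟨⟨_, valued_eval_eq_valued_toPlace_pow_toNat_of_toPlace_eq L v w h2v le_rfl γH hγ.1 hγ.2 hχ.le β hβ⟩, β, hβ⟩

/-! ## §2 SOCKET (Lit): the four literals, their κ-signs and the sign base near `1` -/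

set_option maxHeartbeats 1600000 in
/-- **SOCKET (Lit) of skeleton v6 `stub_typeOne_literals_ram` (A-p16 (g31)), text VERBATIM**: near `1 ∈ H_v`, for `G`-regular non-Levi type-(1) `γ_H`: four matched pairwise
non-conjugate representatives `t b₀ b₁` (★ p846967 at the `X`-frame of `ι((γ_H)_w)`, ★ p847076 §3), a one-place type-(1) eigenframe of `t 0 0` (★ p846987
`onePlace_frame_of_conj_frame`), the κ-signs `κ_v(γ_H, t_b) = s·(−1)^(b₁)` with `s = χ(−det H′_w)` (★ p846987) and the sign base `(s : ℂ) = (y_λ, θ)_v` for `ι_w y_λ = −det H′_w`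
(★ `hilbertSymbol_eq_one_iff_exists_norm_toPlace` ∕ `…_neg_one_iff_not_…`).  (`μ hμu hμω hH′i ϖ hϖ hσϖ` are not used.)
[cite: Rogawski1990, §4.3 (4.3.1)–(4.3.2) p. 43; §4.9 p. 55; §3.5 Prop. 3.5.2 (c) p. 29] [cite: Flicker1998UnitaryFL, §2 Prop. 3 pp. 78–79; §6 p. 95] -/
theorem typeOne_literals_ram
    (L : Type) [Field L] [NumberField L] [IsCMField L] (H' : Matrix (Fin 3) (Fin 3) L) (_μ : HeckeCharacter L)
    {v : HeightOneSpectrum (𝓞 ↥(maximalRealSubfield L))}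
    (hH' : (H'.map (cmConjRingHom L)).transpose = H') (w : PlacesOver L v)
    (hw : IsCMField.complexConj L • w.1 = w.1) (he : v.asIdeal.ramificationIdx' w.1.asIdeal ≠ 1)
    (hH'w : IsUnit (placeForm H' w.1)) (_hH'i : hH'w.unit ∈ glInt 3 (w.1.adicCompletion L))
    (_hμu : _μ.IsUnitary)
    (_hμω : ∀ x : ideleGroup ↥(maximalRealSubfield L), _μ (AdeleRing.ideleBaseChange ↥(maximalRealSubfield L) L x) = quadraticHeckeCharCM L x)
    (h2 : IsUnit (2 : 𝒪[w.1.adicCompletion L]))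
    -- the ramified block (R) and the integral antidiagonal frame of `H′_w` (★ `ramifiedBlock_adicCompletion`, ★ p846344) — SUPPLIED by the contract, BINDERS for the sockets
    (_ϖ : w.1.adicCompletion L) (_hϖ : Valued.v _ϖ = WithZero.exp (-1 : ℤ)) (_hσϖ : galAdicCompletionMap (L := L) (IsCMField.complexConj L) hw _ϖ = -_ϖ)
    (A : GL (Fin 3) (w.1.adicCompletion L)) (hA : A ∈ glInt 3 (w.1.adicCompletion L))
    (hframe : placeForm H' w.1 = (-(placeForm H' w.1).det) • formCongr (galAdicCompletionMap (L := L) (IsCMField.complexConj L) hw) A ((StdForm.antidiagonal 3).over (w.1.adicCompletion L)))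
    -- `y_λ ∈ L⁺_v` with `ι_w y_λ = −det H′_w` (the C-Δ Levi value's Hilbert symbol `(y_λ, θ)_v`)
    (yl : v.adicCompletion ↥(maximalRealSubfield L)) (hyl : toPlace v w yl = -(placeForm H' w.1).det) :
    ∃ V ∈ 𝓝 (1 : ((cmDatum L 2 (Matrix.of fun i j : Fin 2 => if i.val + j.val + 1 = 2 then (1 : L) else 0)).Local v × (cmDatum L 1 (Matrix.of fun i j : Fin 1 => if i.val + j.val + 1 = 1 then (1 : L) else 0)).Local v)),
      ∀ γH ∈ V, IsLocalGRegular L v γH →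
        (∃ x : (w.1.adicCompletion L), (((γH.1.val : GL (Fin 2) (UnitaryGroup.LocalRing L v)).val.map
          (Pi.evalRingHom (fun w' : PlacesOver L v => w'.1.adicCompletion L) w)).charpoly).IsRoot x) →
        ¬ (∃ (y : ((cmDatum L 2 (Matrix.of fun i j : Fin 2 => if i.val + j.val + 1 = 2 then (1 : L) else 0)).Local v × (cmDatum L 1 (Matrix.of fun i j : Fin 1 => if i.val + j.val + 1 = 1 then (1 : L) else 0)).Local v)) (d' : Fin 2 → (UnitaryGroup.LocalRing L v)ˣ),
          glDiagonal 2 (UnitaryGroup.LocalRing L v) d' = ((y * γH * y⁻¹).1.val : GL (Fin 2) (UnitaryGroup.LocalRing L v))) →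
        ∃ (t : Fin 2 → Fin 2 → ((cmDatum L 3 H').Local v)) (Q : GL (Fin 3) (w.1.adicCompletion L)) (x : Fin 3 → (w.1.adicCompletion L)) (s : ℤ),
          (∀ b₀ b₁, IsLocalNormPair L H' v γH (t b₀ b₁)) ∧ (∀ b₀ b₁ b₀' b₁', IsConj (t b₀ b₁) (t b₀' b₁') → b₀ = b₀' ∧ b₁ = b₁') ∧
          ((((localNonsplitEquiv (IsCMField.complexConj L) H' (IsCMField.complexConj_ne_one L) w hw (t 0 0)).val :
              GL (Fin 3) (w.1.adicCompletion L)) : Matrix (Fin 3) (Fin 3) (w.1.adicCompletion L)) * Q.val = Q.val * diagonal x) ∧ Function.Injective x ∧ (∀ i, galAdicCompletionMap (L := L) (IsCMField.complexConj L) hw (x i) * x i = 1) ∧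
          (s = 1 ∨ s = -1) ∧ (∀ b₀ b₁, finKappaAt L v H' γH (t b₀ b₁) = s * (-1) ^ (b₁ : ℕ)) ∧ (s : ℂ) = (hilbertSymbol (v.adicCompletion ↥(maximalRealSubfield L)) yl
        (algebraMap ↥(maximalRealSubfield L) _ ((cmQuadraticGenerator L : 𝓞 ↥(maximalRealSubfield L)) : ↥(maximalRealSubfield L))) : ℂ) := by
  classical
  have hc := IsCMField.complexConj_ne_one L
  have h2v : Valued.v (2 : w.1.adicCompletion L) = 1 := (isUnit_two_integer_iff_valued_eq_one L w.1).1 h2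
  have hH'c : (H'.map (IsCMField.complexConj L))ᵀ = H' := by rw [← map_cmConjRingHom_eq_map_complexConj]; exact hH'
  -- any neighbourhood will do for the literals; take `univ`
  refine ⟨Set.univ, Filter.univ_mem, fun a _ hreg hsplit hlev => ?_⟩
  obtain ⟨α, hα0⟩ := hsplit
  have hα : ((((a.1.val : GL (Fin 2) (UnitaryGroup.LocalRing L v)) : Matrix (Fin 2) (Fin 2) (UnitaryGroup.LocalRing L v)).charpoly).map
      (Pi.evalRingHom (fun w' : PlacesOver L v => w'.1.adicCompletion L) w)).IsRoot α := by
    rw [← Matrix.charpoly_map]; exact hα0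
  -- the semilocal eigenframe of `g = a.1` with `u 0 (w) = α`, norm-one entries (non-Levi), distinct from `u = finGammaTwo` (`G`-regular)
  have hsep : (((a.1.val : GL (Fin 2) (UnitaryGroup.LocalRing L v)) : Matrix (Fin 2) (Fin 2) (UnitaryGroup.LocalRing L v)).charpoly).Separable :=
    (isRegularElt_fst_snd_of_isLocalGRegular L v a hreg).1
  have hef := exists_eigenframe_cmDatum_local_of_isRoot_map_of_separable L v w hw a.1 hα hsep
  obtain ⟨P₂, u, hP₂, hu, -⟩ := hef
  have hu1 : ∀ i, UnitaryGroup.conjLocal L (IsCMField.complexConj L) v (u i) * u i = 1 :=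
    forall_conjLocal_mul_eq_one_of_not_exists_conj_glDiagonal L v w hw hP₂ hu hlev
  have hunit : IsUnit ((finCharpolyTwo L v a).eval (finGammaTwo L v a)) := isUnit_eval_finCharpolyTwo_of_isLocalGRegular L v a hreg
  have hne := ne_finGammaTwo_of_isUnit_eval_of_eigenframe L v a hunit hP₂
  obtain ⟨hab, hbd⟩ := hne
  -- the one-place X-frame (★ p847076 §3)
  have hfr := exists_onePlace_endoGL_frame L v a w hw hP₂
  obtain ⟨Q, hQX⟩ := hfr
  have hxx := injective_and_norm_one_onePlace_of_localRing L v a w hw hu hu1 hab hbd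
  obtain ⟨hxinj, hx1⟩ := hxx
  -- the four representatives (★ p846967)
  have hreps := exists_four_ramified_representatives L H' w hw he h2v hH'w A hA hframe hxinj hx1
  obtain ⟨ε, e, P, t, hσε, -, hεN, hfe, -, hmatch, ht⟩ := hreps
  have htm : ∀ b₀ b₁, IsLocalNormPair L H' v a (t b₀ b₁) := fun b₀ b₁ =>
    (hmatch a (t b₀ b₁)).2 ((ht b₀ b₁).2.2.2.2.2.2.1 _ Q hQX)
  have htQ : ∀ b₀ b₁, (((localNonsplitEquiv (IsCMField.complexConj L) H' hc w hw (t b₀ b₁)).val :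
      GL (Fin 3) (w.1.adicCompletion L)) : Matrix (Fin 3) (Fin 3) (w.1.adicCompletion L)) * (A⁻¹ * P b₀ b₁).val =
        (A⁻¹ * P b₀ b₁).val * diagonal ![u 0 w, finGammaTwo L v a w, u 1 w] := fun b₀ b₁ =>
    onePlace_frame_of_conj_frame (hfe (t b₀ b₁)) (ht b₀ b₁).2.2.2.1
  -- the κ-signs (★ p846987) and the sign base
  obtain ⟨s, hsdef⟩ : ∃ s : ℤ, s = if ∃ z : w.1.adicCompletion L, galAdicCompletionMap (L := L) (IsCMField.complexConj L) hw z * z = -(placeForm H' w.1).det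
      then 1 else -1 := ⟨_, rfl⟩
  have hs : s = 1 ∨ s = -1 := by rw [hsdef]; split_ifs <;> simp
  have hκ : ∀ b₀ b₁, finKappaAt L v H' a (t b₀ b₁) = s * (-1) ^ (b₁ : ℕ) := fun b₀ b₁ => by
    rw [hsdef]
    exact finKappaAt_ramified_representative_eq L H' hH'c w hw hH'w A hframe he h2v hσε hεN a hunit (htm b₀ b₁) (ht b₀ b₁).2.1 (htQ b₀ b₁) hxinj hx1 rfl
  have hyl0 : yl ≠ 0 := fun h0 => by
    have hdet : (placeForm H' w.1).det ≠ 0 := ((Matrix.isUnit_iff_isUnit_det _).1 hH'w).ne_zero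
    apply hdet
    have h1 := hyl
    rw [h0, map_zero] at h1
    exact neg_eq_zero.1 h1.symm
  have hsHS : (s : ℂ) = (hilbertSymbol (v.adicCompletion ↥(maximalRealSubfield L)) yl
      (algebraMap ↥(maximalRealSubfield L) _ ((cmQuadraticGenerator L : 𝓞 ↥(maximalRealSubfield L)) : ↥(maximalRealSubfield L))) : ℂ) := by
    by_cases hN : ∃ z : w.1.adicCompletion L, galAdicCompletionMap (L := L) (IsCMField.complexConj L) hw z * z = -(placeForm H' w.1).det
    · have h1 : s = 1 := by rw [hsdef, if_pos hN]
      have h2 := (hilbertSymbol_eq_one_iff_exists_norm_toPlace L v w hw hyl0).2 (by rw [hyl]; exact hN)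
      rw [h1, h2]
    · have h1 : s = -1 := by rw [hsdef, if_neg hN]
      have h2 := (hilbertSymbol_eq_neg_one_iff_not_exists_norm_toPlace L v w hw hyl0).2 (by rw [hyl]; exact hN)
      rw [h1, h2]
  exact ⟨t, A⁻¹ * P 0 0, ![u 0 w, finGammaTwo L v a w, u 1 w], s, htm, fun b₀ b₁ b₀' b₁' h => (ht b₀ b₁).2.2.2.2.2.2.2 b₀' b₁' h,
    htQ 0 0, hxinj, hx1, hs, hκ, hsHS⟩

/-! ## §3 (Lit⁺): the four FRAMED literals at the spectrum `(α, u_w, γ)`, their κ-signs and the sign base -/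

set_option maxHeartbeats 1600000 in
/-- **(Lit⁺) — THE FRAMED EXPORT** (ED. 2; binders of (Lit) minus the unused `μ hH′i hμu hμω ϖ hϖ hσϖ`, no neighbourhood — the statement is global): for every `G`-regular
non-Levi type-(1) `γ_H` and EVERY ordered pair
of distinct roots `α ≠ γ` of `χ_{g,w}` in `L_w` (the HEAD's `exists_flicker_exponents_split` choice), the whole package of ★ `exists_four_ramified_representatives` AT THE
SPECTRUM `x = (α, u_w, γ)` — the twisting unit `ε` (σ_w-fixed, NOT a norm), the one-place frame `e` with its three clauses, the integral isometries `P_b ∈ GL₃(𝒪_w)` with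
`ᵗσ̄_w P_b J₀ P_b = diag(ε^b₀, ε^b₁, −ε^(b₀+b₁))`, the four literals `e(t_b) = P_b · diag(α, u_w, γ) · P_b⁻¹` (eigenframe, characteristic polynomial, level, matching,
pairwise non-conjugacy) — TOGETHER WITH `x` injective and norm-one (non-Levi: ★ `forall_conjLocal_mul_eq_one_of_not_exists_conj_glDiagonal`), the κ-signs
`κ_v(γ_H, t_b) = s·(−1)^(b₁)` (★ p846987, `u_w` in slot `1`) and the sign base `(s : ℂ) = (y_λ, θ)_v`.  This is (Lit) WITHOUT discarding `ε e P`: the model data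
(`K = L_w`, `T = diag(α, u_w, γ)`, forms `diag(ε^(b₀)·1, ε^(b₁)·1, ε^(b₀+b₁)·(−1))`) on which the junction (J★) is instantiated, so that a (Σ)″ taking these clauses as
hypotheses needs no universal-to-framed reduction. [cite: Rogawski1990, §4.3 (4.3.1)–(4.3.2) p. 43; §4.9 p. 55; §3.5 Prop. 3.5.2 (c) p. 26; §3.6 pp. 28–29]
[cite: Flicker1998UnitaryFL, §2 Prop. 3 pp. 78–79; §6 p. 95] -/
theorem typeOne_literals_framed_ram
    (L : Type) [Field L] [NumberField L] [IsCMField L] (H' : Matrix (Fin 3) (Fin 3) L)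
    {v : HeightOneSpectrum (𝓞 ↥(maximalRealSubfield L))}
    (hH' : (H'.map (cmConjRingHom L)).transpose = H') (w : PlacesOver L v)
    (hw : IsCMField.complexConj L • w.1 = w.1) (he : v.asIdeal.ramificationIdx' w.1.asIdeal ≠ 1)
    (hH'w : IsUnit (placeForm H' w.1))
    (h2 : IsUnit (2 : 𝒪[w.1.adicCompletion L]))
    -- the integral antidiagonal frame of `H′_w` (★ p846344)
    (A : GL (Fin 3) (w.1.adicCompletion L)) (hA : A ∈ glInt 3 (w.1.adicCompletion L))
    (hframe : placeForm H' w.1 = (-(placeForm H' w.1).det) • formCongr (galAdicCompletionMap (L := L) (IsCMField.complexConj L) hw) A ((StdForm.antidiagonal 3).over (w.1.adicCompletion L)))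
    -- `y_λ ∈ L⁺_v` with `ι_w y_λ = −det H′_w` (the C-Δ Levi value's Hilbert symbol `(y_λ, θ)_v`)
    (yl : v.adicCompletion ↥(maximalRealSubfield L)) (hyl : toPlace v w yl = -(placeForm H' w.1).det)
    (γH : ((cmDatum L 2 (Matrix.of fun i j : Fin 2 => if i.val + j.val + 1 = 2 then (1 : L) else 0)).Local v × (cmDatum L 1 (Matrix.of fun i j : Fin 1 => if i.val + j.val + 1 = 1 then (1 : L) else 0)).Local v))
    (hreg : IsLocalGRegular L v γH)
    (hlev : ¬ (∃ (y : ((cmDatum L 2 (Matrix.of fun i j : Fin 2 => if i.val + j.val + 1 = 2 then (1 : L) else 0)).Local v × (cmDatum L 1 (Matrix.of fun i j : Fin 1 => if i.val + j.val + 1 = 1 then (1 : L) else 0)).Local v)) (d' : Fin 2 → (UnitaryGroup.LocalRing L v)ˣ),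
          glDiagonal 2 (UnitaryGroup.LocalRing L v) d' = ((y * γH * y⁻¹).1.val : GL (Fin 2) (UnitaryGroup.LocalRing L v))))
    {α γ : (w.1.adicCompletion L)}
    (hα : ((((γH.1.val : GL (Fin 2) (UnitaryGroup.LocalRing L v)) : Matrix (Fin 2) (Fin 2) (UnitaryGroup.LocalRing L v)).charpoly).map (Pi.evalRingHom (fun w' : PlacesOver L v => w'.1.adicCompletion L) w)).IsRoot α)
    (hγ : ((((γH.1.val : GL (Fin 2) (UnitaryGroup.LocalRing L v)) : Matrix (Fin 2) (Fin 2) (UnitaryGroup.LocalRing L v)).charpoly).map (Pi.evalRingHom (fun w' : PlacesOver L v => w'.1.adicCompletion L) w)).IsRoot γ) (hαγ : α ≠ γ) :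
        ∃ (ε : (w.1.adicCompletion L))
          (e : ((cmDatum L 3 H').Local v) ≃ₜ*
            ↥(unitaryGroupOfForm (galAdicCompletionMap (L := L) (IsCMField.complexConj L) hw)
              (placeForm (Matrix.of fun i j : Fin 3 => if i.val + j.val + 1 = 3 then (1 : L) else 0) w.1)))
          (P : Fin 2 → Fin 2 → GL (Fin 3) (w.1.adicCompletion L))
          (t : Fin 2 → Fin 2 → ((cmDatum L 3 H').Local v)) (s : ℤ),
          -- the twisting unit `ε`: `σ_w`-fixed, a unit, NOT a norm
          galAdicCompletionMap (L := L) (IsCMField.complexConj L) hw ε = ε ∧ Valued.v ε = 1 ∧ (¬ ∃ z : (w.1.adicCompletion L), z * galAdicCompletionMap (L := L) (IsCMField.complexConj L) hw z = ε) ∧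
          -- the one-place frame `e` of `G′_v` (★ p846897): (i) `e g = A · E(g) · A⁻¹`, (ii) `g ∈ K′ ↔ e g ∈ GL₃(𝒪_w)`, (iii) matching = conjugacy with `e b`
          (∀ g, ((e g).val : GL (Fin 3) (w.1.adicCompletion L)) =
            A * (((localNonsplitEquiv (IsCMField.complexConj L) H' (IsCMField.complexConj_ne_one L) w hw g)).val : GL (Fin 3) (w.1.adicCompletion L)) * A⁻¹) ∧
          (∀ g, g ∈ cmLocalIntegralLevel L 3 H' v ↔ ((e g).val : GL (Fin 3) (w.1.adicCompletion L)) ∈ glInt 3 (w.1.adicCompletion L)) ∧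
          (∀ γH' b, IsLocalNormPair L H' v γH' b ↔
            IsConj
              (endoGL
                (((localNonsplitEquiv (IsCMField.complexConj L)
                    (Matrix.of fun i j : Fin 2 => if i.val + j.val + 1 = 2 then (1 : L) else 0) (IsCMField.complexConj_ne_one L) w hw γH'.1).val :
                    GL (Fin 2) (w.1.adicCompletion L)),
                  ((localNonsplitEquiv (IsCMField.complexConj L)
                    (Matrix.of fun i j : Fin 1 => if i.val + j.val + 1 = 1 then (1 : L) else 0) (IsCMField.complexConj_ne_one L) w hw γH'.2).val :
                    GL (Fin 1) (w.1.adicCompletion L))))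
              ((e b).val : GL (Fin 3) (w.1.adicCompletion L))) ∧
          -- the spectrum `(α, u_w, γ)`: pairwise distinct, norm-one
          Function.Injective (![α, finGammaTwo L v γH w, γ] : Fin 3 → (w.1.adicCompletion L)) ∧ (∀ i, galAdicCompletionMap (L := L) (IsCMField.complexConj L) hw ((![α, finGammaTwo L v γH w, γ] : Fin 3 → (w.1.adicCompletion L)) i) * (![α, finGammaTwo L v γH w, γ] : Fin 3 → (w.1.adicCompletion L)) i = 1) ∧
          -- the four framed literals `e (t b₀ b₁) = P_b · diag(α, u_w, γ) · P_b⁻¹`, `ᵗσ̄_w P_b J₀ P_b = diag(ε^b₀, ε^b₁, −ε^(b₀+b₁))`, `P_b ∈ GL₃(𝒪_w)`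
          (∀ b₀ b₁,
            P b₀ b₁ ∈ glInt 3 (w.1.adicCompletion L) ∧
            formCongr (galAdicCompletionMap (L := L) (IsCMField.complexConj L) hw) (P b₀ b₁) ((StdForm.antidiagonal 3).over (w.1.adicCompletion L)) =
              diagonal ![ε ^ (b₀ : ℕ), ε ^ (b₁ : ℕ), -(ε ^ ((b₀ : ℕ) + (b₁ : ℕ)))] ∧
            (((e (t b₀ b₁)).val : GL (Fin 3) (w.1.adicCompletion L)) : Matrix (Fin 3) (Fin 3) (w.1.adicCompletion L)) =
              (P b₀ b₁).val * diagonal ![α, finGammaTwo L v γH w, γ] * ((P b₀ b₁)⁻¹).val ∧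
            (((e (t b₀ b₁)).val : GL (Fin 3) (w.1.adicCompletion L)) : Matrix (Fin 3) (Fin 3) (w.1.adicCompletion L)) * (P b₀ b₁).val = (P b₀ b₁).val * diagonal ![α, finGammaTwo L v γH w, γ] ∧
            ((((t b₀ b₁).val : GL (Fin 3) (UnitaryGroup.LocalRing L v)) : Matrix (Fin 3) (Fin 3) (UnitaryGroup.LocalRing L v)).map
                (Pi.evalRingHom (fun w' : PlacesOver L v => w'.1.adicCompletion L) w)).charpoly =
              (Polynomial.X - Polynomial.C α) * (Polynomial.X - Polynomial.C (finGammaTwo L v γH w)) * (Polynomial.X - Polynomial.C γ) ∧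
            t b₀ b₁ ∈ cmLocalIntegralLevel L 3 H' v ∧ IsLocalNormPair L H' v γH (t b₀ b₁) ∧
            (∀ X Q : GL (Fin 3) (w.1.adicCompletion L), X.val * Q.val = Q.val * diagonal ![α, finGammaTwo L v γH w, γ] → IsConj X ((e (t b₀ b₁)).val : GL (Fin 3) (w.1.adicCompletion L))) ∧
            (∀ b₀' b₁', IsConj (t b₀ b₁) (t b₀' b₁') → b₀ = b₀' ∧ b₁ = b₁')) ∧
          -- the κ-signs and the sign base
          (s = 1 ∨ s = -1) ∧ (∀ b₀ b₁, finKappaAt L v H' γH (t b₀ b₁) = s * (-1) ^ (b₁ : ℕ)) ∧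
          (s : ℂ) = (hilbertSymbol (v.adicCompletion ↥(maximalRealSubfield L)) yl
            (algebraMap ↥(maximalRealSubfield L) _ ((cmQuadraticGenerator L : 𝓞 ↥(maximalRealSubfield L)) : ↥(maximalRealSubfield L))) : ℂ) := by
  classical
  have hc := IsCMField.complexConj_ne_one L
  have h2v : Valued.v (2 : w.1.adicCompletion L) = 1 := (isUnit_two_integer_iff_valued_eq_one L w.1).1 h2
  have hH'c : (H'.map (IsCMField.complexConj L))ᵀ = H' := by
    rw [← map_cmConjRingHom_eq_map_complexConj]; exact hH'
  -- the semilocal eigenframe of `g = γH.1` with `u 0 (w) = α`, `u 1 (w) = γ`, norm-one entries (non-Levi), distinct from `u = finGammaTwo` (`G`-regular)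
  have hsep : (((γH.1.val : GL (Fin 2) (UnitaryGroup.LocalRing L v)) : Matrix (Fin 2) (Fin 2) (UnitaryGroup.LocalRing L v)).charpoly).Separable :=
    (isRegularElt_fst_snd_of_isLocalGRegular L v γH hreg).1
  have hef := exists_eigenframe_cmDatum_local_of_isRoot_map_of_separable L v w hw γH.1 hα hsep
  obtain ⟨P₂, u, hP₂, hu, hu0⟩ := hef
  have hu1w : u 1 w = γ := by
    rcases eq_or_eq_eval_of_isRoot_of_eigenframe L v w (γ := (γH.1.val : GL (Fin 2) (UnitaryGroup.LocalRing L v))) hP₂ hγ with h | h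
    · exact absurd (hu0.symm.trans h.symm) hαγ
    · exact h.symm
  have hu1 : ∀ i, UnitaryGroup.conjLocal L (IsCMField.complexConj L) v (u i) * u i = 1 :=
    forall_conjLocal_mul_eq_one_of_not_exists_conj_glDiagonal L v w hw hP₂ hu hlev
  have hunit : IsUnit ((finCharpolyTwo L v γH).eval (finGammaTwo L v γH)) := isUnit_eval_finCharpolyTwo_of_isLocalGRegular L v γH hreg
  have hne := ne_finGammaTwo_of_isUnit_eval_of_eigenframe L v γH hunit hP₂
  obtain ⟨hab, hbd⟩ := hne
  -- the one-place X-frame (★ p847076 §3)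
  have hfr := exists_onePlace_endoGL_frame L v γH w hw hP₂
  obtain ⟨Q, hQX⟩ := hfr
  have hxx := injective_and_norm_one_onePlace_of_localRing L v γH w hw hu hu1 hab hbd
  obtain ⟨hxinj, hx1⟩ := hxx
  subst hu0 hu1w
  -- the four representatives (★ p846967)
  have hreps := exists_four_ramified_representatives L H' w hw he h2v hH'w A hA hframe hxinj hx1
  obtain ⟨ε, e, P, t, hσε, hεv, hεN, hfe, hK, hmatch, ht⟩ := hreps
  have htm : ∀ b₀ b₁, IsLocalNormPair L H' v γH (t b₀ b₁) := fun b₀ b₁ =>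
    (hmatch γH (t b₀ b₁)).2 ((ht b₀ b₁).2.2.2.2.2.2.1 _ Q hQX)
  have htQ : ∀ b₀ b₁, (((localNonsplitEquiv (IsCMField.complexConj L) H' hc w hw (t b₀ b₁)).val :
      GL (Fin 3) (w.1.adicCompletion L)) : Matrix (Fin 3) (Fin 3) (w.1.adicCompletion L)) * (A⁻¹ * P b₀ b₁).val =
        (A⁻¹ * P b₀ b₁).val * diagonal ![u 0 w, finGammaTwo L v γH w, u 1 w] := fun b₀ b₁ =>
    onePlace_frame_of_conj_frame (hfe (t b₀ b₁)) (ht b₀ b₁).2.2.2.1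
  -- the κ-signs (★ p846987) and the sign base
  obtain ⟨s, hsdef⟩ : ∃ s : ℤ, s = if ∃ z : w.1.adicCompletion L, galAdicCompletionMap (L := L) (IsCMField.complexConj L) hw z * z = -(placeForm H' w.1).det
      then 1 else -1 := ⟨_, rfl⟩
  have hs : s = 1 ∨ s = -1 := by rw [hsdef]; split_ifs <;> simp
  have hκ : ∀ b₀ b₁, finKappaAt L v H' γH (t b₀ b₁) = s * (-1) ^ (b₁ : ℕ) := fun b₀ b₁ => by
    rw [hsdef]
    exact finKappaAt_ramified_representative_eq L H' hH'c w hw hH'w A hframe he h2v hσε hεN γH hunit (htm b₀ b₁) (ht b₀ b₁).2.1 (htQ b₀ b₁) hxinj hx1 rfl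
  have hyl0 : yl ≠ 0 := fun h0 => by
    have hdet : (placeForm H' w.1).det ≠ 0 := ((Matrix.isUnit_iff_isUnit_det _).1 hH'w).ne_zero
    apply hdet
    have h1 := hyl
    rw [h0, map_zero] at h1
    exact neg_eq_zero.1 h1.symm
  have hsHS : (s : ℂ) = (hilbertSymbol (v.adicCompletion ↥(maximalRealSubfield L)) yl
      (algebraMap ↥(maximalRealSubfield L) _ ((cmQuadraticGenerator L : 𝓞 ↥(maximalRealSubfield L)) : ↥(maximalRealSubfield L))) : ℂ) := by
    by_cases hN : ∃ z : w.1.adicCompletion L, galAdicCompletionMap (L := L) (IsCMField.complexConj L) hw z * z = -(placeForm H' w.1).det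
    · have h1 : s = 1 := by rw [hsdef, if_pos hN]
      have h2 := (hilbertSymbol_eq_one_iff_exists_norm_toPlace L v w hw hyl0).2 (by rw [hyl]; exact hN)
      rw [h1, h2]
    · have h1 : s = -1 := by rw [hsdef, if_neg hN]
      have h2 := (hilbertSymbol_eq_neg_one_iff_not_exists_norm_toPlace L v w hw hyl0).2 (by rw [hyl]; exact hN)
      rw [h1, h2]
  exact ⟨ε, e, P, t, s, hσε, hεv, hεN, hfe, hK, hmatch, hxinj, hx1, fun b₀ b₁ =>
    ⟨(ht b₀ b₁).1, (ht b₀ b₁).2.1, (ht b₀ b₁).2.2.1, (ht b₀ b₁).2.2.2.1, (ht b₀ b₁).2.2.2.2.1, (ht b₀ b₁).2.2.2.2.2.1, htm b₀ b₁,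
      (ht b₀ b₁).2.2.2.2.2.2.1, (ht b₀ b₁).2.2.2.2.2.2.2⟩, hs, hκ, hsHS⟩

end Sockets

end Literature.NumberTheory.Rogawski1990

end
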